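import Literature.NumberTheory.Sieve.HeathBrownCubicLemma92Orbit
import HarnessLib

/-!
# Lemma 9.2 for one character: `T(χ) = ε(χ)·𝓘/(γ₀M(ξ log X)^{n+1}) + O(…)` ((9.16), (9.20), p. 60)

Part of the reduction *Lemma 9.2 ⇐ Lemma 9.4* in §9 of D. R. Heath-Brown, *Primes represented by `x³ + 2y³`*,
Acta Math. 186 (2001) (this seat's route to the named fact `HeathBrown2001_lemma_3_8`). Page 60: "Comparing this
with (9.20), we conclude that `γ₀Δ³V ∑_{β∈𝒞} d_{(β)}χ(β) = ε(χ)γ₀M⁻¹(ξ log X)^{−n−1}Δ³V𝓘 + O(Δ⁴V²) + O(Δ^{−2}M^{−1}V² exp{−c√(log L)})`.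
We therefore choose `Δ = exp{−(1/6)c√(log L)}`, whence `∑_{β∈𝒞} d_{(β)}χ(β) = ε(χ)γ₀⁻¹M⁻¹(ξ log X)^{−n−1}𝓘 + O(V exp{−(1/6)c√(log L)})`.
Lemma 9.2 then follows." This file PROVES the combination step with explicit (not yet specialised) error terms:

* `phaseFn_one`; **`norm_Jint_sub_main_le`** — (9.16)–(9.17): a uniform bound `|E(𝐱) − ε(χ)Δ²main(𝐱)| ≤ Err` on `𝒞`
  gives `|𝓙 − ε(χ)Δ²∫_𝒞 main| ≤ Err·S₀³`;
* **`norm_Tchi_sub_main_le`** — `|T(χ) − ε(χ)𝓘/(γ₀M₀)| ≤ G + Err·S₀³/(γ₀Δ³V) + err₈/(γ₀ΔV·M₀)` from the four inputs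
  `𝓙 = ∑_v d_v𝓙_v`, `|∑_v d_v𝓙_v − γ₀Δ³V·T(χ)| ≤ γ₀Δ³V·G`, `|𝓙 − ε(χ)Δ²·Im/M₀| ≤ Err·S₀³`, `|Im − ΔV𝓘| ≤ err₈`
  (`M₀ = M(ξ log X)^{n+1}`, `Im = ∫_𝒞 m`);
* `integrableOn_phaseFn_mul_Esum` (through `Esum_eq_ElatSum`);
* lattice counts: `card_Ioc_floor_le`, `le_card_Ioc_floor`, `card_latticeCube_le` (`≤ (S+1)³`), `le_card_latticeCube`
  (`≥ (S−1)³`), **`card_boundary_le`** (`#{outer ∖ inner} ≤ 8S₀²(2ρ+1)`, "the number of such `β` is `O(ΔV)`", p. 60);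
* `corner_bounds` (`|a_i + S₀| ≤ c₃V^{1/3}`, `S₀ ≤ 4c₃V^{1/3}`), `norm_castVec_le_of_mem_bigCube` (`‖v̂‖ ≤ 5c₃V^{1/3} + 2r`).

## References

* D. R. Heath-Brown, *Primes represented by `x³ + 2y³`*, Acta Math. 186 (2001), §9 pp. 58–60, (9.16)–(9.22).
  [cite: HeathBrownActa2001, §9 (9.16)–(9.22), p. 60]

## Mathlib / tree search

Tree: `Jint`, `Jv`, `Esum_eq_ElatSum`, `integrableOn_Jv_integrand`, `phaseFn`, `norm_phaseFn` (`HeathBrownCubicLemma92Lattice`), `Tchi`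
(`HeathBrownCubicLemma92Orbit`), `charAngle_one` (`HeathBrownCubicGrossen`), `cubeIntegral`, `gamma₀_pos` (`HeathBrownCubicSiegelWalfisz`),
`volume_realCube`, `mem_latticeCube_iff`, `mem_Ioc_floor_iff` (`HeathBrownCubicCubeSums`), `side_pow_three_le_of_cubeCond` (pattern for
`corner_bounds`). Mathlib: `norm_setIntegral_le_of_norm_le_const`, `integral_complex_ofReal`, `Int.card_Ioc`, `Finset.card_sdiff_of_subset`,
`norm_add₃_le`.
-/

noncomputable section

open Polynomial NumberField Finset Complex MeasureTheory

namespace Literature.NumberTheory.Sieve.CubicSieve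

open LFunctions.CubeRootTwoField CubicPrimes Literature.Analysis.Fourier

variable {X τ : ℝ} {n : ℕ} {m : Fin (n + 1) → ℕ} {q : ℕ} (hq : 1 ≤ q) (χ : MulChar (QuotMod q) ℂ)

/-- For the trivial character the phase is `1` (`t(χ₀) = 0`). [folklore] -/
theorem phaseFn_one (x : ℝ × ℝ × ℝ) : phaseFn (1 : MulChar (QuotMod q) ℂ) x = 1 := by
  rw [phaseFn, charAngle_one, zero_mul, Complex.ofReal_zero, zero_mul, Complex.exp_zero]

/-- **`𝓙` through Lemma 9.3** ((9.16)–(9.17)): if `|E(𝐱) − ε(χ)Δ²·main(𝐱)| ≤ Err` uniformly on the cube then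
`|𝓙 − ε(χ)Δ² ∫_𝒞 main| ≤ Err·S₀³` (for `χ = χ₀` the phase is `1`; for `χ ≠ χ₀` it has modulus `1`).
[cite: HeathBrownActa2001, §9 (9.16)–(9.17)] -/
theorem norm_Jint_sub_main_le [Decidable (χ = 1)] {Δ V : ℝ} {a : ℝ × ℝ × ℝ} {S₀ : ℝ} (hS₀ : 0 ≤ S₀)
    (hint : IntegrableOn (fun x => phaseFn χ x * Esum X τ m hq χ Δ V x) (realCube a S₀))
    {main : ℝ × ℝ × ℝ → ℝ} (hmain : IntegrableOn main (realCube a S₀)) {Err : ℝ}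
    (hErr : ∀ x ∈ realCube a S₀, ‖Esum X τ m hq χ Δ V x - (if χ = 1 then ((Δ ^ 2 * main x : ℝ) : ℂ) else 0)‖ ≤ Err) :
    ‖Jint X τ m hq χ Δ V a S₀ - (if χ = 1 then ((Δ ^ 2 * ∫ x in realCube a S₀, main x : ℝ) : ℂ) else 0)‖ ≤ Err * S₀ ^ 3 := by
  have hvol : volume (realCube a S₀) < ⊤ := by rw [volume_realCube a hS₀]; exact ENNReal.ofReal_lt_top
  have hreal : (volume (realCube a S₀)).toReal = S₀ ^ 3 := by rw [volume_realCube a hS₀, ENNReal.toReal_ofReal (by positivity)]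
  by_cases h1 : χ = 1
  · subst h1
    simp only [if_true] at hErr ⊢
    have hint' : IntegrableOn (fun x => Esum X τ m hq (1 : MulChar (QuotMod q) ℂ) Δ V x) (realCube a S₀) :=
      hint.congr_fun (fun x _ => by simp only [phaseFn_one, one_mul]) (measurableSet_realCube a S₀)
    have hmainC : IntegrableOn (fun x => (((Δ ^ 2 * main x : ℝ)) : ℂ)) (realCube a S₀) := (hmain.const_mul (Δ ^ 2)).ofReal
    have heq : Jint X τ m hq (1 : MulChar (QuotMod q) ℂ) Δ V a S₀ - ((Δ ^ 2 * ∫ x in realCube a S₀, main x : ℝ) : ℂ) =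
        ∫ x in realCube a S₀, (Esum X τ m hq (1 : MulChar (QuotMod q) ℂ) Δ V x - ((Δ ^ 2 * main x : ℝ) : ℂ)) := by
      rw [integral_sub hint' hmainC, Jint]
      congr 1
      · exact setIntegral_congr_fun (measurableSet_realCube a S₀) fun x _ => by rw [phaseFn_one, one_mul]
      · push_cast
        rw [← integral_complex_ofReal, ← integral_const_mul]
    rw [heq, ← hreal]
    exact norm_setIntegral_le_of_norm_le_const hvol hErr
  · simp only [if_neg h1, sub_zero] at hErr ⊢
    rw [Jint, ← hreal]
    refine norm_setIntegral_le_of_norm_le_const hvol fun x hx => ?_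
    rw [norm_mul, norm_phaseFn, one_mul]; exact hErr x hx

/-- **Lemma 9.2 for one character, combined** ((9.20)–(9.22) and p. 60: "`γ₀Δ³V ∑_{β∈𝒞} d_{(β)}χ(β)
= ε(χ)γ₀M⁻¹(ξ log X)^{−n−1}Δ³V𝓘 + O(…)`"): from
(i) `𝓙 = ∑_v d_v 𝓙_v` (`Jint_eq_sum_Jv`), (ii) `|∑_v d_v𝓙_v − γ₀Δ³V·T(χ)| ≤ γ₀Δ³V·G` (`norm_sum_Jv_sub_le`),
(iii) `|𝓙 − ε(χ)Δ²∫_𝒞 m/(M(ξ log X)^{n+1})| ≤ Err·S₀³` (`norm_Jint_sub_main_le`), (iv) `|∫_𝒞 m − ΔV𝓘| ≤ err₈`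
(`HeathBrownCubicWindowIntegral`), dividing by `γ₀Δ³V`:
`|T(χ) − ε(χ)𝓘/(γ₀M(ξ log X)^{n+1})| ≤ G + Err·S₀³/(γ₀Δ³V) + err₈/(γ₀ΔV·M(ξ log X)^{n+1})`.
[cite: HeathBrownActa2001, §9 (9.20)–(9.22), p. 60] -/
theorem norm_Tchi_sub_main_le [Decidable (χ = 1)] {Δ V : ℝ} (hΔ : 0 < Δ) (hV : 0 < V) {a : ℝ × ℝ × ℝ} {S₀ : ℝ}
    {M₀ : ℝ} (hM₀ : 0 < M₀) {J Jsum : ℂ} {G Err err₈ Im : ℝ}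
    (hi : J = Jsum)
    (hii : ‖Jsum - (gamma₀ * Δ ^ 3 * V : ℝ) * Tchi χ X τ m a S₀‖ ≤ gamma₀ * Δ ^ 3 * V * G)
    (hiii : ‖J - (if χ = 1 then ((Δ ^ 2 * (Im / M₀) : ℝ) : ℂ) else 0)‖ ≤ Err * S₀ ^ 3)
    (hiv : |Im - Δ * V * cubeIntegral X τ m a S₀| ≤ err₈) :
    ‖Tchi χ X τ m a S₀ - (if χ = 1 then ((cubeIntegral X τ m a S₀ / (gamma₀ * M₀) : ℝ) : ℂ) else 0)‖ ≤
      G + Err * S₀ ^ 3 / (gamma₀ * Δ ^ 3 * V) + err₈ / (gamma₀ * Δ * V * M₀) := by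
  have hγ := gamma₀_pos
  set I₀ : ℝ := gamma₀ * Δ ^ 3 * V with hI₀
  have hI₀0 : 0 < I₀ := by positivity
  -- the main terms
  have hmainI : (I₀ : ℂ) * (if χ = 1 then ((cubeIntegral X τ m a S₀ / (gamma₀ * M₀) : ℝ) : ℂ) else 0) =
      (if χ = 1 then ((Δ ^ 2 * (Δ * V * cubeIntegral X τ m a S₀ / M₀) : ℝ) : ℂ) else 0) := by
    have hγC : (gamma₀ : ℂ) ≠ 0 := by exact_mod_cast hγ.ne'
    have hM₀C : (M₀ : ℂ) ≠ 0 := by exact_mod_cast hM₀.ne'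
    split_ifs
    · rw [hI₀]; push_cast; field_simp
    · rw [mul_zero]
  have hstep : ‖(if χ = 1 then ((Δ ^ 2 * (Im / M₀) : ℝ) : ℂ) else 0) -
      (if χ = 1 then ((Δ ^ 2 * (Δ * V * cubeIntegral X τ m a S₀ / M₀) : ℝ) : ℂ) else 0)‖ ≤ Δ ^ 2 * err₈ / M₀ := by
    split_ifs
    · rw [← Complex.ofReal_sub, Complex.norm_real, Real.norm_eq_abs, ← mul_sub, ← sub_div, abs_mul, abs_div,
        abs_of_pos (pow_pos hΔ 2), abs_of_pos hM₀, mul_div_assoc]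
      exact mul_le_mul_of_nonneg_left (div_le_div_of_nonneg_right hiv hM₀.le) (by positivity)
    · rw [sub_zero, norm_zero]; exact div_nonneg (by positivity) hM₀.le |>.trans' le_rfl |> fun h => by
        have : 0 ≤ Δ ^ 2 * err₈ / M₀ := by
          have h8 : 0 ≤ err₈ := (abs_nonneg _).trans hiv
          positivity
        exact this
  -- assemble `I₀ (T − main) = (I₀T − Jsum) + (J − ε main') + (ε main' − ε I₀ main)`
  have hkey : ‖(I₀ : ℂ) * (Tchi χ X τ m a S₀ - (if χ = 1 then ((cubeIntegral X τ m a S₀ / (gamma₀ * M₀) : ℝ) : ℂ) else 0))‖ ≤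
      I₀ * G + Err * S₀ ^ 3 + Δ ^ 2 * err₈ / M₀ := by
    have hdecomp : (I₀ : ℂ) * (Tchi χ X τ m a S₀ - (if χ = 1 then ((cubeIntegral X τ m a S₀ / (gamma₀ * M₀) : ℝ) : ℂ) else 0)) =
        -(Jsum - (I₀ : ℂ) * Tchi χ X τ m a S₀) + (J - (if χ = 1 then ((Δ ^ 2 * (Im / M₀) : ℝ) : ℂ) else 0)) +
          ((if χ = 1 then ((Δ ^ 2 * (Im / M₀) : ℝ) : ℂ) else 0) -
            (if χ = 1 then ((Δ ^ 2 * (Δ * V * cubeIntegral X τ m a S₀ / M₀) : ℝ) : ℂ) else 0)) := by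
      rw [mul_sub, hmainI, hi]; ring
    rw [hdecomp]
    refine (norm_add₃_le).trans ?_
    rw [norm_neg]
    exact add_le_add (add_le_add hii hiii) hstep
  rw [norm_mul, Complex.norm_real, Real.norm_eq_abs, abs_of_pos hI₀0] at hkey
  rw [← mul_le_mul_iff_of_pos_left hI₀0]
  refine hkey.trans (le_of_eq ?_)
  have hsplit : I₀ * (G + Err * S₀ ^ 3 / (gamma₀ * Δ ^ 3 * V) + err₈ / (gamma₀ * Δ * V * M₀)) =
      I₀ * G + I₀ / (gamma₀ * Δ ^ 3 * V) * (Err * S₀ ^ 3) + I₀ / (gamma₀ * Δ * V * M₀) * err₈ := by ring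
  have h1 : I₀ / (gamma₀ * Δ ^ 3 * V) = 1 := by rw [hI₀]; exact div_self hI₀0.ne'
  have h2 : I₀ / (gamma₀ * Δ * V * M₀) = Δ ^ 2 / M₀ := by
    rw [hI₀, div_eq_div_iff (by positivity) hM₀.ne']; ring
  rw [hsplit, h1, h2, one_mul]
  ring

/-! ### Integrability of `e^{itv⁻¹log β}E` on the cube (through the lattice form) -/

/-- `e^{itv⁻¹log β(𝐱)}E(𝐱)` is integrable on `𝒞` (it agrees there with the finite sum `Ẽ` of integrable terms). [folklore] -/
theorem integrableOn_phaseFn_mul_Esum {C₀ : ℝ} (h95 : Lemma95Bound C₀) (hC₀ : 0 < C₀)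
    {c₃ c₄ V Δ : ℝ} (hc₄ : 0 < c₄) (hV : 0 < V) (hΔ : 0 < Δ) (hΔ16 : Δ ≤ 1 / 16) (hΔc : Δ ≤ c₄ / 2)
    (hκ : C₀ * (1 + 1 / c₄) * Δ ≤ 1 / 2) {a : ℝ × ℝ × ℝ} {S₀ : ℝ} (hcube : CubeCond c₃ c₄ V a S₀)
    {r : ℝ} (hr : 2 * (C₀ * (1 + 1 / c₄) * Δ) * (c₃ * V ^ (1 / 3 : ℝ)) ≤ r) :
    IntegrableOn (fun x => phaseFn χ x * Esum X τ m hq χ Δ V x) (realCube a S₀) := by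
  have heq : ∀ x ∈ realCube a S₀, phaseFn χ x * Esum X τ m hq χ Δ V x =
      ∑ v ∈ (latticeCube (a.1 - 2 * r, a.2.1 - 2 * r, a.2.2 - 2 * r) (S₀ + 3 * r)).filter
          (fun v => 0 < ell (castVec v) ∧ Δ * V < normForm (castVec v)),
        phaseFn χ x * (((dWeight X τ m (Ideal.span {coordElt v}) : ℂ) * nu0O χ (coordElt v)) *
          (orbitIntegrand Δ V (castVec v) x : ℂ)) := by
    intro x hx
    rw [Esum_eq_ElatSum hq χ h95 hC₀ hc₄ hV hΔ hΔ16 hΔc hκ hcube hr hx, ElatSum, Finset.mul_sum]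
  refine IntegrableOn.congr_fun ?_ (fun x hx => (heq x hx).symm) (measurableSet_realCube a S₀)
  exact integrable_finsetSum _ fun v hv => integrableOn_Jv_integrand χ hΔ hV (Finset.mem_filter.mp hv).2 a S₀ _

/-! ### Lattice point counts -/

/-- `#(ℤ ∩ (a, a + S]) ≤ S + 1` and `≥ S − 1`. [folklore] -/
theorem card_Ioc_floor_le (a : ℝ) {S : ℝ} (hS : 0 ≤ S) : ((Finset.Ioc ⌊a⌋ ⌊a + S⌋).card : ℝ) ≤ S + 1 := by
  rw [Int.card_Ioc]
  have h1 : ((⌊a + S⌋ - ⌊a⌋ : ℤ) : ℝ) ≤ S + 1 := by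
    push_cast
    have := Int.floor_le (a + S); have := Int.lt_floor_add_one a; linarith
  have h2 : (0 : ℝ) ≤ ((⌊a + S⌋ - ⌊a⌋ : ℤ) : ℝ) := by
    have : ⌊a⌋ ≤ ⌊a + S⌋ := Int.floor_le_floor (by linarith)
    exact_mod_cast sub_nonneg.mpr this
  have : ((⌊a + S⌋ - ⌊a⌋).toNat : ℝ) = ((⌊a + S⌋ - ⌊a⌋ : ℤ) : ℝ) := by
    rw [← Int.cast_natCast, Int.toNat_of_nonneg (by exact_mod_cast h2)]
  rw [this]; exact h1

/-- `#(ℤ ∩ (a, a + S]) ≥ S − 1`. [folklore] -/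
theorem le_card_Ioc_floor (a S : ℝ) : S - 1 ≤ ((Finset.Ioc ⌊a⌋ ⌊a + S⌋).card : ℝ) := by
  rw [Int.card_Ioc]
  have h1 : S - 1 ≤ ((⌊a + S⌋ - ⌊a⌋ : ℤ) : ℝ) := by
    push_cast
    have := Int.floor_le a; have := Int.lt_floor_add_one (a + S); linarith
  refine h1.trans ?_
  exact_mod_cast Int.self_le_toNat _

/-- `#latticeCube a S ≤ (S + 1)³` (`S ≥ 0`). [folklore] -/
theorem card_latticeCube_le (a : ℝ × ℝ × ℝ) {S : ℝ} (hS : 0 ≤ S) : ((latticeCube a S).card : ℝ) ≤ (S + 1) ^ 3 := by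
  rw [latticeCube, Finset.card_product, Finset.card_product]
  push_cast
  have h1 := card_Ioc_floor_le a.1 hS
  have h2 := card_Ioc_floor_le a.2.1 hS
  have h3 := card_Ioc_floor_le a.2.2 hS
  have h0 : ∀ t : ℕ, (0 : ℝ) ≤ t := fun t => Nat.cast_nonneg t
  calc ((Finset.Ioc ⌊a.1⌋ ⌊a.1 + S⌋).card : ℝ) * (((Finset.Ioc ⌊a.2.1⌋ ⌊a.2.1 + S⌋).card : ℝ) * ((Finset.Ioc ⌊a.2.2⌋ ⌊a.2.2 + S⌋).card : ℝ))
      ≤ (S + 1) * ((S + 1) * (S + 1)) := by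
        refine mul_le_mul h1 (mul_le_mul h2 h3 (h0 _) (by linarith)) (mul_nonneg (h0 _) (h0 _)) (by linarith)
    _ = (S + 1) ^ 3 := by ring

/-- `#latticeCube a S ≥ (S − 1)³` (`S ≥ 1`). [folklore] -/
theorem le_card_latticeCube (a : ℝ × ℝ × ℝ) {S : ℝ} (hS : 1 ≤ S) : (S - 1) ^ 3 ≤ ((latticeCube a S).card : ℝ) := by
  rw [latticeCube, Finset.card_product, Finset.card_product]
  push_cast
  have h1 := le_card_Ioc_floor a.1 S
  have h2 := le_card_Ioc_floor a.2.1 S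
  have h3 := le_card_Ioc_floor a.2.2 S
  have hS0 : 0 ≤ S - 1 := by linarith
  calc (S - 1) ^ 3 = (S - 1) * ((S - 1) * (S - 1)) := by ring
    _ ≤ ((Finset.Ioc ⌊a.1⌋ ⌊a.1 + S⌋).card : ℝ) * (((Finset.Ioc ⌊a.2.1⌋ ⌊a.2.1 + S⌋).card : ℝ) * ((Finset.Ioc ⌊a.2.2⌋ ⌊a.2.2 + S⌋).card : ℝ)) :=
        mul_le_mul h1 (mul_le_mul h2 h3 hS0 (Nat.cast_nonneg _)) (mul_nonneg hS0 hS0) (Nat.cast_nonneg _)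

open scoped Classical in
/-- **The boundary count** ("the number of such `β` is `O(ΔV)`", p. 60): the lattice points of the outer cube
`(a − ρ, a + S₀ + ρ]³` not in the inner cube `(a + ρ, a + S₀ − ρ]³` number at most `(S₀ + 2ρ + 1)³ − (S₀ − 2ρ − 1)³ ≤ 8S₀²(2ρ + 1)`
(`0 ≤ ρ`, `2ρ + 1 ≤ S₀`, hence also `1 ≤ S₀ − 2ρ`). [cite: HeathBrownActa2001, §9 p. 60] -/
theorem card_boundary_le (a : ℝ × ℝ × ℝ) {S₀ ρ : ℝ} (hρ : 0 ≤ ρ) (hρS : 2 * ρ + 1 ≤ S₀) :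
    (((latticeCube (a.1 - ρ, a.2.1 - ρ, a.2.2 - ρ) (S₀ + 2 * ρ)).filter
        (fun v => castVec v ∉ realCube (a.1 + ρ, a.2.1 + ρ, a.2.2 + ρ) (S₀ - 2 * ρ))).card : ℝ) ≤ 8 * S₀ ^ 2 * (2 * ρ + 1) := by
  set Lout := latticeCube (a.1 - ρ, a.2.1 - ρ, a.2.2 - ρ) (S₀ + 2 * ρ) with hLout
  set Linn := latticeCube (a.1 + ρ, a.2.1 + ρ, a.2.2 + ρ) (S₀ - 2 * ρ) with hLinn
  have hsub : Linn ⊆ Lout := by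
    intro v hv
    rw [hLinn, mem_latticeCube_iff, mem_realCube] at hv
    rw [hLout, mem_latticeCube_iff, mem_realCube]
    obtain ⟨⟨a1, b1⟩, ⟨a2, b2⟩, ⟨a3, b3⟩⟩ := hv
    simp only at a1 b1 a2 b2 a3 b3 ⊢
    exact ⟨⟨by linarith, by linarith⟩, ⟨by linarith, by linarith⟩, ⟨by linarith, by linarith⟩⟩
  have hfilt : Lout.filter (fun v => castVec v ∉ realCube (a.1 + ρ, a.2.1 + ρ, a.2.2 + ρ) (S₀ - 2 * ρ)) = Lout \ Linn := by
    ext v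
    rw [Finset.mem_filter, Finset.mem_sdiff, hLinn, mem_latticeCube_iff (a := (a.1 + ρ, a.2.1 + ρ, a.2.2 + ρ))]
  rw [hfilt, Finset.card_sdiff_of_subset hsub, Nat.cast_sub (Finset.card_le_card hsub)]
  have h1 := card_latticeCube_le (a.1 - ρ, a.2.1 - ρ, a.2.2 - ρ) (S := S₀ + 2 * ρ) (by linarith)
  have h2 := le_card_latticeCube (a.1 + ρ, a.2.1 + ρ, a.2.2 + ρ) (S := S₀ - 2 * ρ) (by linarith)
  rw [← hLout] at h1; rw [← hLinn] at h2
  have hu : 2 * ρ + 1 ≤ S₀ := hρS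
  nlinarith [sq_nonneg (2 * ρ + 1), sq_nonneg S₀, mul_nonneg hρ (by linarith : (0 : ℝ) ≤ S₀)]

/-! ### The size of the lattice points of the enlarged cube -/

/-- On the cube of Lemma 3.8 (`S₀ > 0`): `|a_i + S₀| ≤ c₃V^{1/3}` and `S₀ ≤ 4c₃V^{1/3}`. [folklore] -/
theorem corner_bounds {c₃ c₄ V : ℝ} {a : ℝ × ℝ × ℝ} {S₀ : ℝ} (hS₀ : 0 < S₀) (hcube : CubeCond c₃ c₄ V a S₀) :
    (|a.1 + S₀| ≤ c₃ * V ^ (1 / 3 : ℝ) ∧ |a.2.1 + S₀| ≤ c₃ * V ^ (1 / 3 : ℝ) ∧ |a.2.2 + S₀| ≤ c₃ * V ^ (1 / 3 : ℝ)) ∧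
      S₀ ≤ 4 * (c₃ * V ^ (1 / 3 : ℝ)) := by
  have hp1 : (a.1 + S₀, a.2.1 + S₀, a.2.2 + S₀) ∈ realCube a S₀ := by
    simp only [realCube, Set.mem_prod, Set.mem_Ioc]
    exact ⟨⟨by linarith, le_rfl⟩, ⟨by linarith, le_rfl⟩, by linarith, le_rfl⟩
  have hp2 : (a.1 + S₀ / 2, a.2.1 + S₀, a.2.2 + S₀) ∈ realCube a S₀ := by
    simp only [realCube, Set.mem_prod, Set.mem_Ioc]
    exact ⟨⟨by linarith, by linarith⟩, ⟨by linarith, le_rfl⟩, by linarith, le_rfl⟩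
  obtain ⟨h1, h2, h3, -⟩ := hcube _ hp1
  have h4 := (hcube _ hp2).1
  simp only at h1 h2 h3 h4
  refine ⟨⟨h1, h2, h3⟩, ?_⟩
  have hS : S₀ / 2 ≤ 2 * (c₃ * V ^ (1 / 3 : ℝ)) := by
    calc S₀ / 2 = |(a.1 + S₀) - (a.1 + S₀ / 2)| := by rw [abs_of_pos (by linarith)]; ring
      _ ≤ |a.1 + S₀| + |a.1 + S₀ / 2| := abs_sub _ _
      _ ≤ c₃ * V ^ (1 / 3 : ℝ) + c₃ * V ^ (1 / 3 : ℝ) := add_le_add h1 h4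
      _ = 2 * (c₃ * V ^ (1 / 3 : ℝ)) := by ring
  linarith

/-- The lattice points of the enlarged cube `(a − 2r, a + S₀ + r]³` have sup norm `≤ 5c₃V^{1/3} + 2r`. [folklore] -/
theorem norm_castVec_le_of_mem_bigCube {c₃ c₄ V : ℝ} {a : ℝ × ℝ × ℝ} {S₀ : ℝ} (hS₀ : 0 < S₀) (hcube : CubeCond c₃ c₄ V a S₀)
    {r : ℝ} (hr : 0 ≤ r) {v : ℤ × ℤ × ℤ} (hv : v ∈ latticeCube (a.1 - 2 * r, a.2.1 - 2 * r, a.2.2 - 2 * r) (S₀ + 3 * r)) :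
    ‖castVec v‖ ≤ 5 * (c₃ * V ^ (1 / 3 : ℝ)) + 2 * r := by
  obtain ⟨⟨h1, h2, h3⟩, hS⟩ := corner_bounds hS₀ hcube
  rw [mem_latticeCube_iff, mem_realCube] at hv
  obtain ⟨⟨a1, b1⟩, ⟨a2, b2⟩, ⟨a3, b3⟩⟩ := hv
  simp only at a1 b1 a2 b2 a3 b3
  rw [Prod.norm_def, Prod.norm_def, Real.norm_eq_abs, Real.norm_eq_abs, Real.norm_eq_abs]
  rw [abs_le] at h1 h2 h3
  refine max_le ?_ (max_le ?_ ?_) <;> rw [abs_le] <;> constructor <;> linarith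

end Literature.NumberTheory.Sieve.CubicSieve
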